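import Literature.Combinatorics.SimpleGraph.ReducedDivisorsDhar
import Literature.Combinatorics.SimpleGraph.MatrixTreeTheorem
import Literature.Combinatorics.SimpleGraph.SpanningTreeParentMap
import Mathlib.Data.Fin.Tuple.Sort
import Mathlib.Order.Interval.Finset.Fin
import HarnessLib

/-!
# The `K_{n+1}`-parking functions are the classical parking functions of size `n`, and there are
# `(n+1)^{n−1}` of them (Postnikov–Shapiro 2004, §2; Cayley–Kreweras)

Source (held, read at the page; statements VERBATIM). A. Postnikov, B. Shapiro, *Trees, parking
functions, syzygies, and deformations of monomial ideals*, Trans. Amer. Math. Soc. 356 (2004)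
3109–3142 [PostnikovShapiro2004] (held text `paper:arxiv-math_0301110`, chunks p0005 and p0007),
§2 «`G`-parking functions»: «A parking function of size `n` is a sequence `b = (b_1,…,b_n)` of
non-negative integers such that its increasing rearrangement `c_1 ≤ ⋯ ≤ c_n` satisfies `c_i < i`.
Equivalently, we can formulate this condition as `#{i ∣ b_i < r} ≥ r`, for `r = 1,…,n`. The
parking functions of size `n` are known to be in bijective correspondence with trees on `n + 1`
labelled vertices, see Kreweras [Krew]. Thus, according to Cayley's formula for the number of
labelled trees, the total number of parking functions of size `n` equals `(n+1)^{n−1}`. […] For a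
subset `I` in `{1,…,n}` and a vertex `i ∈ I`, let `d_I(i) = Σ_{j ∉ I} a_{ij}`, i.e., `d_I(i)` is
the number of edges from the vertex `i` to a vertex outside of the subset `I`. Let us say that a
sequence `b = (b_1,…,b_n)` of non-negative integers is a `G`-parking function if, for any nonempty
subset `I ⊆ {1,…,n}`, there exists `i ∈ I` such that `b_i < d_I(i)`. If `G = K_{n+1}` is the
complete graph on `n + 1` vertices then `K_{n+1}`-parking functions are the usual parking
functions of size `n` defined in the beginning of this section. **Theorem 2.1.** cf. [Gab1] The
number of `G`-parking functions equals the number `N_G = det L_G` of oriented spanning trees of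
the digraph `G`.»; §4.1: «Suppose that `G = K_{n+1}` is the complete graph on `n + 1` vertices. As
we have already mentioned, the `K_{n+1}`-parking functions are the usual parking functions of
size `n`».

## What is formalised (vocabulary: `IsReduced G q D` of `ReducedDivisors` — B–N's `q`-reduced
## divisors, i.e. `G`-parking functions relative to `q` (vertex `0` of P–S is the base vertex `q`);
## the counts `card_isReduced_eq_card_spanningTrees` (`ReducedDivisorsDhar`, P–S Theorem 2.1 for
## graphs) and Cayley's formula `MatrixTreeTheorem.card_spanningTrees_top` of the lineage)

* `IsParkingFunction b` — the classical parking functions in P–S's rearrangement-free form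
  (`#{i ∣ b_i < r} ≥ r` for `r = 1,…,n`), on any finite index type of size `n`; API:
  `IsParkingFunction.lt_card` (`b_i < n`), `IsParkingFunction.mono` (an order ideal),
  `IsParkingFunction.comp_equiv` (invariance under relabelling); and the primary, sorted form
  of the definition: **`isParkingFunction_iff_of_monotone`** (for any increasing rearrangement
  `e`, parking iff `c_i < i`, `i = 1,…,n`) and `isParkingFunction_iff_sort` (with Mathlib's
  `Tuple.sort`);
* on the complete graph the out-degree of `v ∈ A` towards the complement is `(n+1) − |A|`
  (`card_top_neighborFinset_sdiff_add_card`), whence **`isReduced_top_iff`** and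
  **`isReduced_top_iff_isParkingFunction`**: «`K_{n+1}`-parking functions are the usual parking
  functions of size `n`»;
* counting: `card_isReduced_top` (the `q`-reduced divisors of `K_{n+1}` of a fixed degree number
  `(n+1)^{n−1}`), `card_isParkingFunction_subtype`, and **`card_isParkingFunction`** /
  `card_isParkingFunction_fin`: «the total number of parking functions of size `n` equals
  `(n+1)^{n−1}`»; `card_isParkingFunction_eq_card_isTree` («in bijective correspondence with
  trees on `n + 1` labelled vertices», as a count) and the source's indexing
  `isReduced_top_fin_iff_isParkingFunction_succ` (vertices `Fin (n+1)`, base `0`, the sequence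
  `(D 1, …, D n)`).

One definition (`IsParkingFunction`), theorems otherwise; no `sorry`; no named facts.
-/

open Finset SimpleGraph
open Literature.Combinatorics.SimpleGraph.MatrixTreeTheorem

namespace Literature.Combinatorics.SimpleGraph.BakerNorine

/-! ### §1 Classical parking functions -/

section Parking

variable {ι κ : Type*} [Fintype ι] [Fintype κ]

/-- A **parking function** of size `n = |ι|`: «a sequence `b = (b_1,…,b_n)` of non-negative
integers such that its increasing rearrangement `c_1 ≤ ⋯ ≤ c_n` satisfies `c_i < i`. Equivalently,
we can formulate this condition as `#{i ∣ b_i < r} ≥ r`, for `r = 1,…,n`» — we take the second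
(rearrangement-free) form, over an arbitrary finite index type. [cite: PostnikovShapiro2004, §2] -/
def IsParkingFunction (b : ι → ℕ) : Prop :=
  ∀ r : ℕ, 1 ≤ r → r ≤ Fintype.card ι → r ≤ #{i | b i < r}

/-- Unfolding `IsParkingFunction`. [cite: PostnikovShapiro2004, §2] -/
theorem isParkingFunction_iff (b : ι → ℕ) :
    IsParkingFunction b ↔ ∀ r : ℕ, 1 ≤ r → r ≤ Fintype.card ι → r ≤ #{i | b i < r} := Iff.rfl

/-- Every entry of a parking function of size `n` is `< n` (the case `r = n`: all `n` entries are
`< n`, i.e. `c_n < n`). [cite: PostnikovShapiro2004, §2] -/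
theorem IsParkingFunction.lt_card {b : ι → ℕ} (h : IsParkingFunction b) (i : ι) :
    b i < Fintype.card ι := by
  have hn : 1 ≤ Fintype.card ι := Fintype.card_pos_iff.2 ⟨i⟩
  have hle := h (Fintype.card ι) hn le_rfl
  have heq : #{j | b j < Fintype.card ι} = Fintype.card ι :=
    le_antisymm (card_le_univ _) hle
  have hmem : i ∈ ({j | b j < Fintype.card ι} : Finset ι) := by
    rw [Finset.eq_univ_of_card _ heq]; exact mem_univ i
  exact (mem_filter.1 hmem).2

/-- Parking functions form an order ideal: `b′ ≤ b` entrywise and `b` parking imply `b′` parking.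
[cite: PostnikovShapiro2004, §2] -/
theorem IsParkingFunction.mono {b b' : ι → ℕ} (h : IsParkingFunction b) (hle : b' ≤ b) :
    IsParkingFunction b' := fun r hr hrn =>
  (h r hr hrn).trans (card_le_card fun i hi => by
    simp only [mem_filter, mem_univ, true_and] at hi ⊢
    exact (hle i).trans_lt hi)

/-- Parking functions are invariant under relabelling the index set («sequence» up to the
symmetric group: the condition only involves `#{i ∣ b_i < r}`). [cite: PostnikovShapiro2004, §2] -/
theorem IsParkingFunction.comp_equiv {b : ι → ℕ} (h : IsParkingFunction b) (e : κ ≃ ι) :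
    IsParkingFunction (b ∘ e) := by
  intro r hr hrn
  rw [Fintype.card_congr e] at hrn
  refine (h r hr hrn).trans (le_of_eq ?_)
  refine (Finset.card_equiv e fun i => ?_).symm
  simp only [mem_filter, mem_univ, true_and, Function.comp_apply]

end Parking

/-! ### §1b The sorted form of the definition: `c_i < i` -/

section Sorted

variable {ι : Type*} [Fintype ι]

/-- **The two forms of the definition agree**: «a sequence `b = (b_1,…,b_n)` of non-negative
integers such that its increasing rearrangement `c_1 ≤ ⋯ ≤ c_n` satisfies `c_i < i`.
Equivalently, […] `#{i ∣ b_i < r} ≥ r`, for `r = 1,…,n`» — for any increasing rearrangement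
`e : Fin n ≃ ι` of `b` (so `c_{j+1} = b (e j)` for `j = 0,…,n−1`), `b` is a parking function iff
`b (e j) < j + 1` for all `j`. [cite: PostnikovShapiro2004, §2] -/
theorem isParkingFunction_iff_of_monotone {n : ℕ} {b : ι → ℕ} (e : Fin n ≃ ι)
    (he : Monotone (b ∘ e)) : IsParkingFunction b ↔ ∀ j : Fin n, b (e j) < (j : ℕ) + 1 := by
  classical
  have hn : Fintype.card ι = n := (Fintype.card_congr e).symm.trans (Fintype.card_fin n)
  constructor
  · intro h j
    by_contra hge
    rw [not_lt] at hge
    have hle := h ((j : ℕ) + 1) (by omega) (by rw [hn]; omega)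
    -- every `i` with `b i < j + 1 ≤ c_{j+1}` comes before position `j` in the rearrangement
    have hsub : ({i | b i < (j : ℕ) + 1} : Finset ι) ⊆ (Finset.Iio j).map e.toEmbedding := by
      intro i hi
      rw [Finset.mem_map]
      refine ⟨e.symm i, Finset.mem_Iio.2 ?_, e.apply_symm_apply i⟩
      by_contra hk
      rw [not_lt] at hk
      have hmono : b (e j) ≤ b (e (e.symm i)) := he hk
      rw [e.apply_symm_apply] at hmono
      have hlt := (mem_filter.1 hi).2
      omega
    have hcard := card_le_card hsub
    rw [card_map, Fin.card_Iio] at hcard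
    omega
  · intro h r hr hrn
    rw [hn] at hrn
    -- the first `r` positions of the rearrangement carry values `< r`
    set j : Fin n := ⟨r - 1, by omega⟩
    have hsub : (Finset.Iic j).map e.toEmbedding ⊆ ({i | b i < r} : Finset ι) := by
      intro i hi
      rw [Finset.mem_map] at hi
      obtain ⟨k, hk, rfl⟩ := hi
      have hkj : (k : ℕ) ≤ r - 1 := by
        have h' : k ≤ j := Finset.mem_Iic.1 hk
        rw [Fin.le_iff_val_le_val] at h'
        exact h'
      have hk' := h k
      exact mem_filter.2 ⟨mem_univ _, by simp only [Equiv.coe_toEmbedding]; omega⟩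
    have hcard := card_le_card hsub
    rw [card_map, Fin.card_Iic] at hcard
    have hj : (j : ℕ) = r - 1 := rfl
    omega

/-- In particular with Mathlib's sorting permutation `Tuple.sort b` of `b : Fin n → ℕ` (the
increasing rearrangement `c = b ∘ sort b`): `b` is a parking function iff `c_j < j + 1` for
`j = 0,…,n−1`, i.e. «`c_i < i`» in the source's `1`-based indexing.
[cite: PostnikovShapiro2004, §2] -/
theorem isParkingFunction_iff_sort {n : ℕ} (b : Fin n → ℕ) :
    IsParkingFunction b ↔ ∀ j : Fin n, b (Tuple.sort b j) < (j : ℕ) + 1 :=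
  isParkingFunction_iff_of_monotone (Tuple.sort b) (Tuple.monotone_sort b)

end Sorted

/-! ### §2 `q`-reduced divisors on the complete graph `K_{n+1}` -/

section Complete

variable {V : Type*} [Fintype V] [DecidableEq V]

/-- On the complete graph, «the number of edges from the vertex `i` to a vertex outside of the
subset `I`» is `d_I(i) = (n+1) − |I|` for `i ∈ I`. [cite: PostnikovShapiro2004, §2] -/
theorem card_top_neighborFinset_sdiff_add_card {A : Finset V} {v : V} (hv : v ∈ A) :
    #((⊤ : SimpleGraph V).neighborFinset v \ A) + #A = Fintype.card V := by
  have h : (⊤ : SimpleGraph V).neighborFinset v \ A = univ \ A := by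
    ext w
    simp only [mem_sdiff, mem_neighborFinset, top_adj, mem_univ, true_and]
    exact ⟨fun h => h.2, fun h => ⟨fun hvw => h (hvw ▸ hv), h⟩⟩
  rw [h, card_sdiff_add_card_eq_card (subset_univ A), card_univ]

/-- **«`K_{n+1}`-parking functions are the usual parking functions of size `n`»**, in the tree's
language of `q`-reduced divisors: a divisor `D` on the complete graph on `n + 1` vertices is
`q`-reduced iff `D(v) ≥ 0` for `v ≠ q` and `#{v ≠ q ∣ D(v) < r} ≥ r` for `r = 1,…,n`.
[cite: PostnikovShapiro2004, §2 (and §4.1)] -/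
theorem isReduced_top_iff (q : V) (D : V → ℤ) :
    IsReduced (⊤ : SimpleGraph V) q D ↔
      (∀ v, v ≠ q → 0 ≤ D v) ∧
        ∀ r : ℕ, 1 ≤ r → r < Fintype.card V → r ≤ #{v ∈ univ.erase q | D v < r} := by
  have hVq : #(univ.erase q) + 1 = Fintype.card V := by
    rw [card_erase_of_mem (mem_univ q), card_univ]
    have := Fintype.card_pos_iff.2 ⟨q⟩
    omega
  constructor
  · rintro ⟨h1, h2⟩
    refine ⟨h1, fun r hr hrn => ?_⟩
    by_contra hlt
    rw [not_le] at hlt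
    -- `A`: the vertices `≠ q` holding at least `r` dollars
    have hsplit : #{v ∈ univ.erase q | (r : ℤ) ≤ D v} + #{v ∈ univ.erase q | D v < r} =
        #(univ.erase q) := by
      have h := Finset.card_filter_add_card_filter_not (s := univ.erase q) (fun v => (r : ℤ) ≤ D v)
      simp_rw [not_le] at h
      exact h
    have hqA : q ∉ ({v ∈ univ.erase q | (r : ℤ) ≤ D v} : Finset V) := by simp
    have hAne : ({v ∈ univ.erase q | (r : ℤ) ≤ D v} : Finset V).Nonempty := by
      rw [← card_pos]; omega
    obtain ⟨v, hvA, hvlt⟩ := h2 _ hAne hqA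
    have hout := card_top_neighborFinset_sdiff_add_card hvA
    have hrv : (r : ℤ) ≤ D v := (mem_filter.1 hvA).2
    omega
  · rintro ⟨h1, h2⟩
    refine ⟨h1, fun A hAne hqA => ?_⟩
    by_contra hno
    push Not at hno
    have hAsub : A ⊆ univ.erase q := fun v hv =>
      mem_erase.2 ⟨fun h => hqA (h ▸ hv), mem_univ v⟩
    have hAcard := (card_le_card hAsub)
    have hApos := card_pos.2 hAne
    -- `r := (n+1) − |A|` lies in `1,…,n`
    obtain ⟨v₀, hv₀⟩ := hAne
    have hout₀ := card_top_neighborFinset_sdiff_add_card hv₀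
    set r : ℕ := #((⊤ : SimpleGraph V).neighborFinset v₀ \ A) with hr_def
    have hr1 : 1 ≤ r := by omega
    have hrn : r < Fintype.card V := by omega
    have hle := h2 r hr1 hrn
    -- but every vertex with fewer than `r` dollars lies outside `A`
    have hsub : ({v ∈ univ.erase q | D v < r} : Finset V) ⊆ univ.erase q \ A := by
      intro v hv
      rw [mem_sdiff]
      refine ⟨(mem_filter.1 hv).1, fun hvA => ?_⟩
      have h' := hno v hvA
      have hout := card_top_neighborFinset_sdiff_add_card hvA
      have hlt : D v < (r : ℤ) := (mem_filter.1 hv).2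
      omega
    have hcard := card_le_card hsub
    rw [card_sdiff_of_subset hAsub] at hcard
    omega

/-- The same statement with the parking-function predicate: `D` is `q`-reduced on `K_{n+1}` iff
`D ≥ 0` off `q` and `v ↦ D(v)` (`v ≠ q`) is a parking function of size `n`.
[cite: PostnikovShapiro2004, §2 (and §4.1)] -/
theorem isReduced_top_iff_isParkingFunction (q : V) (D : V → ℤ) :
    IsReduced (⊤ : SimpleGraph V) q D ↔
      (∀ v, v ≠ q → 0 ≤ D v) ∧ IsParkingFunction fun v : {v // v ≠ q} => (D v).toNat := by
  rw [isReduced_top_iff]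
  refine and_congr_right fun _ => ?_
  have hcardS : Fintype.card {v // v ≠ q} + 1 = Fintype.card V := by
    rw [Fintype.card_subtype, filter_ne', card_erase_of_mem (mem_univ q), card_univ]
    have := Fintype.card_pos_iff.2 ⟨q⟩
    omega
  have hcount : ∀ r : ℕ, 1 ≤ r →
      #{i : {v // v ≠ q} | (D i).toNat < r} = #{v ∈ univ.erase q | D v < r} := by
    intro r hr
    have hr0 : 0 < r := hr
    rw [← Fintype.card_subtype, Fintype.card_congr
      (Equiv.subtypeSubtypeEquivSubtypeInter (fun v => v ≠ q) (fun v => (D v).toNat < r)),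
      Fintype.card_subtype]
    congr 1
    ext v
    simp only [mem_filter, mem_univ, true_and, mem_erase, and_true, Int.toNat_lt' hr0]
  constructor
  · intro h r hr hrn
    rw [hcount r hr]
    exact h r hr (by omega)
  · intro h r hr hrn
    rw [← hcount r hr]
    exact h r hr (by omega)

end Complete

/-! ### §3 Counting: `(n+1)^{n−1}` parking functions of size `n` -/

section Count

variable {V : Type*} [Fintype V] [DecidableEq V]

/-- The `q`-reduced divisors of a fixed degree on the complete graph `K_m` number `m^{m−2}`
(P–S Theorem 2.1 on `K_m` with Cayley's formula; in the tree: reduced divisors are counted by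
spanning trees). [cite: PostnikovShapiro2004, §2 (Theorem 2.1)] -/
theorem card_isReduced_top [Nonempty V] (q : V) (d : ℤ) :
    Nat.card {D : V → ℤ // IsReduced (⊤ : SimpleGraph V) q D ∧ ∑ v, D v = d} =
      Fintype.card V ^ (Fintype.card V - 2) := by
  rw [card_isReduced_eq_card_spanningTrees SimpleGraph.connected_top q d, card_spanningTrees_top]

/-- Parking functions on the `n` non-base vertices of `K_{n+1}` correspond to the `q`-reduced
divisors of any fixed degree `d` (the value at `q` is forced by the degree); hence they number
`(n+1)^{n−1}`. [cite: PostnikovShapiro2004, §2] -/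
theorem card_isParkingFunction_subtype (q : V) :
    Nat.card {b : {v // v ≠ q} → ℕ // IsParkingFunction b} =
      Fintype.card V ^ (Fintype.card V - 2) := by
  haveI : Nonempty V := ⟨q⟩
  rw [← card_isReduced_top q 0]
  have hsum : ∀ D : V → ℤ, ∑ v ∈ univ.erase q, D v = ∑ i : {v // v ≠ q}, D i := fun D =>
    Finset.sum_subtype _ (fun v => by simp) _
  refine Nat.card_congr
    { toFun := fun b => ⟨fun v => if h : v ≠ q then (b.1 ⟨v, h⟩ : ℤ) else -∑ i, (b.1 i : ℤ), ?_, ?_⟩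
      invFun := fun D => ⟨fun i => (D.1 i).toNat,
        ((isReduced_top_iff_isParkingFunction q D.1).1 D.2.1).2⟩
      left_inv := fun b => ?_
      right_inv := fun D => ?_ }
  · -- `q`-reduced: nonnegative off `q`, and the parking condition is that of `b`
    rw [isReduced_top_iff_isParkingFunction]
    refine ⟨fun v hv => by rw [dif_pos hv]; exact Nat.cast_nonneg _, ?_⟩
    convert b.2 using 1
    funext i
    simp only [dif_pos i.2, Int.toNat_natCast]
  · -- degree `0`
    rw [← Finset.add_sum_erase _ _ (mem_univ q), dif_neg (not_not.2 rfl), hsum]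
    have h2 : ∀ i : {v // v ≠ q},
        (if h : (i : V) ≠ q then (b.1 ⟨i, h⟩ : ℤ) else -∑ j, (b.1 j : ℤ)) = b.1 i := fun i => by
      rw [dif_pos i.2]
    simp only [h2]
    omega
  · apply Subtype.ext
    funext i
    simp only [dif_pos i.2, Subtype.coe_eta, Int.toNat_natCast]
  · obtain ⟨D, hD, hdeg⟩ := D
    apply Subtype.ext
    funext v
    dsimp only
    by_cases hv : v ≠ q
    · simp only [dif_pos hv]
      exact Int.toNat_of_nonneg (hD.nonneg hv)
    · rw [dif_neg hv]
      rw [not_not] at hv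
      rw [hv]
      have h1 : ∑ i : {w // w ≠ q}, ((D i).toNat : ℤ) = ∑ i : {w // w ≠ q}, D i :=
        Finset.sum_congr rfl fun i _ => Int.toNat_of_nonneg (hD.nonneg i.2)
      rw [h1, ← hsum]
      rw [← Finset.add_sum_erase _ _ (mem_univ q)] at hdeg
      omega

/-- **«The total number of parking functions of size `n` equals `(n+1)^{n−1}`»** (Kreweras'
bijection with labelled trees on `n + 1` vertices and Cayley's formula; here through the
`q`-reduced divisors of `K_{n+1}` and the matrix-tree count). [cite: PostnikovShapiro2004, §2] -/
theorem card_isParkingFunction (ι : Type*) [Fintype ι] :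
    Nat.card {b : ι → ℕ // IsParkingFunction b} = (Fintype.card ι + 1) ^ (Fintype.card ι - 1) := by
  classical
  -- relabel `ι` as the non-base vertices of `K_{n+1}` on `Option ι` with base vertex `none`
  let e : {v : Option ι // v ≠ none} ≃ ι :=
    (Equiv.subtypeEquivRight fun v => Option.ne_none_iff_isSome).trans (Equiv.optionIsSomeEquiv ι)
  have hexp : Fintype.card (Option ι) - 2 = Fintype.card ι - 1 := by
    rw [Fintype.card_option]; omega
  rw [← Fintype.card_option, ← hexp, ← card_isParkingFunction_subtype (none : Option ι)]
  exact Nat.card_congr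
    { toFun := fun b => ⟨b.1 ∘ e, b.2.comp_equiv e⟩
      invFun := fun b => ⟨b.1 ∘ e.symm, b.2.comp_equiv e.symm⟩
      left_inv := fun b => by ext i; simp
      right_inv := fun b => by ext i; simp }

/-- The literal form: the parking functions `b = (b_1,…,b_n)` of size `n` number `(n+1)^{n−1}`.
[cite: PostnikovShapiro2004, §2] -/
theorem card_isParkingFunction_fin (n : ℕ) :
    Nat.card {b : Fin n → ℕ // IsParkingFunction b} = (n + 1) ^ (n - 1) := by
  rw [card_isParkingFunction, Fintype.card_fin]

/-- **«The parking functions of size `n` are known to be in bijective correspondence with trees on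
`n + 1` labelled vertices»** (Kreweras), here as an equality of cardinalities through
`(n+1)^{n−1}` and Cayley's formula (the tree's `SpanningTreeParentMap.card_isTree`).
[cite: PostnikovShapiro2004, §2] -/
theorem card_isParkingFunction_eq_card_isTree (n : ℕ) :
    Nat.card {b : Fin n → ℕ // IsParkingFunction b} =
      Nat.card {T : SimpleGraph (Fin (n + 1)) // T.IsTree} := by
  rw [card_isParkingFunction_fin, SpanningTreeParentMap.card_isTree, Fintype.card_fin]
  rfl

/-- The source's indexing: on `K_{n+1}` with vertex set `Fin (n + 1)` and base vertex `0`, a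
divisor `D` is `0`-reduced iff `D ≥ 0` off `0` and the sequence `(D(1), …, D(n))` is a parking
function of size `n` («`K_{n+1}`-parking functions are the usual parking functions of size `n`»).
[cite: PostnikovShapiro2004, §2 (and §4.1)] -/
theorem isReduced_top_fin_iff_isParkingFunction_succ (n : ℕ) (D : Fin (n + 1) → ℤ) :
    IsReduced (⊤ : SimpleGraph (Fin (n + 1))) 0 D ↔
      (∀ i, i ≠ 0 → 0 ≤ D i) ∧ IsParkingFunction fun i : Fin n => (D i.succ).toNat := by
  rw [isReduced_top_iff_isParkingFunction]
  refine and_congr_right fun _ => ?_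
  -- relabel `{v // v ≠ 0}` by `Fin n` through `Fin.succ = Fin.succAbove 0`
  let e : Fin n ≃ {v : Fin (n + 1) // v ≠ 0} := (finSuccAboveOrderIso 0).toEquiv
  have he : ∀ i : Fin n, ((e i : {v : Fin (n + 1) // v ≠ 0}) : Fin (n + 1)) = i.succ := fun i => by
    show Fin.succAbove 0 i = i.succ
    rw [Fin.succAbove_zero]
  constructor
  · intro h
    have h' := h.comp_equiv e
    convert h' using 1
    funext i
    simp only [Function.comp_apply, he]
  · intro h
    have h' := h.comp_equiv e.symm
    convert h' using 1
    funext v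
    simp only [Function.comp_apply]
    congr 2
    have := he (e.symm v)
    rw [Equiv.apply_symm_apply] at this
    exact this

end Count

end Literature.Combinatorics.SimpleGraph.BakerNorine
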